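import Mathlib
import Summits.NavierStokesRegularity.NavierStokesRegularity.Theorems.FilamentSkeletonRssSkeletonJ1NormalBlockWindow

/-!
# `SkeletonJ1` (stmt-NavierStokesRegularity-27413, Variant A1α) · registered stub `stub_normalBlock` — the CORE CEILING near a uniformly
# supercritical zero (companion of `FilamentSkeletonRssSkeletonJ1NormalBlockWindow`, §4 of that story, split off for the 400-line rule)

WHAT IS PROVED (sorry-free, standard axioms; pure real analysis).  Under the similarity-frame core-area law `w·A′ = (3/2 − w′)·A + 4`
(`A > 0`, `w`, `A` differentiable, `w(c) = 0`):
* `slip_ge_linear_of_supercritical` — `3/2 + δ' ≤ w′` on `|s − c| ≤ r` gives `(3/2 + δ')(s − c) ≤ w(s)` on `[c, c + r]`;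
* `areaLaw_ceiling_right` — then `A(τ) ≤ 4/δ'` for `c < τ ≤ c + r`: with `Q = w·A`, `Q′ = 1.5·A + 4 ≤ β·Q/(s − c) + 4`, `β = 1.5/(1.5 + δ') < 1`,
  the Fuchsian comparison function `(Q − 4(s − c)/(1 − β))·(s − c)^{−β}` is antitone on `(c, c + r]` and tends to `0` at `c⁺`, hence `≤ 0`;
* `areaLaw_ceiling_window` — both sides (`|τ − c| ≤ r`), by the reflection `s ↦ 2c − s`, `w ↦ −w`, which preserves the area law.
USE.  Together with §3 of the companion file (FLOOR `4/Λ ≤ Aa` from `|w′| ≤ Λ`) this turns the core-window hypothesis of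
`SkeletonJ1NormalBlockWindow.normalBlock_of_coreWindow` (= registered `stub_normalBlock` of the birth skeleton 12616aef6aab368d + window) into ONE
slip-regularity hypothesis: `|w′| ≤ Λ` (the near-straight regime) and `w′ ≥ 3/2 + δ'` on `|s − c_j| ≤ √(4κ/δ')` (`κ = e^{−(1+γ_E−log 2)}`) give
`κ·Aa_j ∈ [4κ/Λ, 4κ/δ']` on that window.  The registered A1α text carries `w′(c_j) ≥ 3/2 + δ` AT the zero only — the uniform version on an
`O(1)` window is the precise remaining gap (repair census in NOTES / cell bus).
HONEST FRAMING: bookkeeping about a HYPOTHETICAL filament skeleton on the NEGATIVE side of a MODEL route (A1α aside); `SkeletonJ1` stays OPEN;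
nothing here bears on Navier–Stokes regularity or blow-up.  `--supports stmt-NavierStokesRegularity-27413`.
-/

set_option linter.dupNamespace false

noncomputable section

namespace Summit.NavierStokesRegularity.NavierStokesRegularity.Theorems.SkeletonJ1NormalBlockCeiling

open Set Function Filter MeasureTheory Real
open scoped InnerProductSpace Topology

/-! ## The core CEILING near a UNIFORMLY supercritical zero: area law + `3/2 + δ' ≤ w′` on
`|s − c_j| ≤ r` ⇒ `Aa ≤ 4/δ'` on that window (Fuchsian comparison at the zero).  With §3 this turns the core window of §2 into ONE regularity
hypothesis on the slip: `|w′| ≤ Λ` (near-straight regime) and `w′ ≥ 3/2 + δ'` on `|s − c_j| ≤ √(4κ/δ')` give `κ·Aa ∈ [4κ/Λ, 4κ/δ']` there. -/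

/-- Uniform supercriticality `3/2 + δ' ≤ w′` on `|s − c| ≤ r` and `w(c) = 0` give the linear slip lower bound `(3/2 + δ')(s − c) ≤ w(s)`
on `[c, c + r]`. [folklore] -/
theorem slip_ge_linear_of_supercritical {w : ℝ → ℝ} {c δ' r : ℝ} (hw : Differentiable ℝ w) (hc : w c = 0)
    (hsup : ∀ s, |s - c| ≤ r → 3 / 2 + δ' ≤ deriv w s) {s : ℝ} (hs : c ≤ s) (hsr : s - c ≤ r) :
    (3 / 2 + δ') * (s - c) ≤ w s := by
  have hmono : MonotoneOn (fun x => w x - (3 / 2 + δ') * x) (Icc c (c + r)) := by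
    apply monotoneOn_of_deriv_nonneg (convex_Icc c (c + r))
    · exact (hw.continuous.sub (continuous_const.mul continuous_id)).continuousOn
    · intro x _
      exact ((hw x).sub ((differentiableAt_id).const_mul _)).differentiableWithinAt
    · intro x hx
      rw [interior_Icc] at hx
      have hx' : |x - c| ≤ r := by rw [abs_of_nonneg (by linarith [hx.1])]; linarith [hx.2]
      have hd : HasDerivAt (fun x => w x - (3 / 2 + δ') * x) (deriv w x - (3 / 2 + δ') * 1) x :=
        (hw x).hasDerivAt.sub ((hasDerivAt_id' x).const_mul _)
      rw [hd.deriv]; linarith [hsup x hx']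
  have h := hmono ⟨le_rfl, by linarith⟩ ⟨hs, by linarith⟩ hs
  simp only [hc] at h
  linarith

/-- **CORE CEILING to the right of a uniformly supercritical zero.**  Under the area law `w·A′ = (3/2 − w′)·A + 4` (`A > 0`, `w`, `A`
differentiable, `w(c) = 0`), if `3/2 + δ' ≤ w′` on `|s − c| ≤ r` (`δ' > 0`) then `A(τ) ≤ 4/δ'` for `c < τ ≤ c + r`.
Proof: `Q = w·A` has `Q′ = 1.5·A + 4 ≤ β·Q/(s − c) + 4` with `β = 1.5/(1.5 + δ') < 1` (slip `≥ (1.5 + δ')(s − c)`); the Fuchsian comparison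
function `(Q − 4(s − c)/(1 − β))·(s − c)^{−β}` is antitone on `(c, c + r]` and tends to `0` at `c⁺`, hence is `≤ 0`; so
`Q ≤ 4(s − c)/(1 − β)` and `A = Q/w ≤ 4/((1 − β)(1.5 + δ')) = 4/δ'`. [folklore] -/
theorem areaLaw_ceiling_right {w A : ℝ → ℝ} {c δ' r : ℝ} (hw : Differentiable ℝ w) (hA : Differentiable ℝ A)
    (hlaw : ∀ τ, w τ * deriv A τ = (3 / 2 - deriv w τ) * A τ + 4) (hpos : ∀ τ, 0 < A τ) (hc : w c = 0)
    (hδ : 0 < δ') (hsup : ∀ s, |s - c| ≤ r → 3 / 2 + δ' ≤ deriv w s) {τ : ℝ} (hτ : c < τ) (hτr : τ - c ≤ r) :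
    A τ ≤ 4 / δ' := by
  -- constants
  set lam : ℝ := 3 / 2 + δ' with hlam
  have hlam0 : 0 < lam := by rw [hlam]; positivity
  set β : ℝ := (3 / 2) / lam with hβ
  have hβ0 : 0 < β := by rw [hβ]; positivity
  have hβ1 : β < 1 := by rw [hβ, div_lt_one hlam0, hlam]; linarith
  have h1β : 0 < 1 - β := by linarith
  have hβlam : (1 - β) * lam = δ' := by rw [hβ, hlam]; field_simp; ring
  -- slip lower bound
  have hwlow : ∀ s, c ≤ s → s - c ≤ r → lam * (s - c) ≤ w s := fun s hs hsr =>
    slip_ge_linear_of_supercritical hw hc hsup hs hsr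
  -- `Q = w·A`, the comparison `D = Q − 4(s − c)/(1 − β)` and their derivatives
  set Q : ℝ → ℝ := fun s => w s * A s with hQ
  have hQd : ∀ s, HasDerivAt Q (3 / 2 * A s + 4) s :=
    Summit.NavierStokesRegularity.NavierStokesRegularity.Theorems.SkeletonJ1NormalBlockWindow.areaLaw_hasDerivAt_mul hw hA hlaw
  set D : ℝ → ℝ := fun s => Q s - (4 / (1 - β)) * (s - c) with hD
  have hDd : ∀ s, HasDerivAt D (3 / 2 * A s + 4 - 4 / (1 - β)) s := fun s => by
    have h2 : HasDerivAt (fun x => (4 / (1 - β)) * (x - c)) (4 / (1 - β)) s := by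
      simpa using ((hasDerivAt_id s).sub_const c).const_mul (4 / (1 - β))
    exact (hQd s).sub h2
  have hDc : D c = 0 := by simp [hD, hQ, hc]
  -- the Fuchsian differential inequality `(s − c)·D′ ≤ β·D` on `(c, c + r]`
  have hkey : ∀ s, c < s → s - c ≤ r → (s - c) * (3 / 2 * A s + 4 - 4 / (1 - β)) ≤ β * D s := by
    intro s hs hsr
    have hsc : 0 < s - c := sub_pos.2 hs
    have hws : lam * (s - c) ≤ w s := hwlow s hs.le hsr
    have hAl : (s - c) * A s * lam ≤ Q s := by
      have : lam * (s - c) * A s ≤ w s * A s := mul_le_mul_of_nonneg_right hws (hpos s).le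
      simp only [hQ]; linarith
    have h15 : (s - c) * (3 / 2 * A s) ≤ β * Q s := by
      have hl : (3 / 2) / lam * ((s - c) * A s * lam) ≤ (3 / 2) / lam * Q s :=
        mul_le_mul_of_nonneg_left hAl (by positivity)
      have he : (3 / 2) / lam * ((s - c) * A s * lam) = (s - c) * (3 / 2 * A s) := by
        field_simp
      rw [hβ]; linarith
    have hrest : (s - c) * (4 - 4 / (1 - β)) = -(β * ((4 / (1 - β)) * (s - c))) := by
      field_simp; ring
    have hsplit : (s - c) * (3 / 2 * A s + 4 - 4 / (1 - β)) =
        (s - c) * (3 / 2 * A s) + (s - c) * (4 - 4 / (1 - β)) := by ring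
    rw [hsplit, hrest]
    simp only [hD]
    linarith
  -- the weighted comparison function `g = D·(s − c)^{−β}` and its derivative
  set g : ℝ → ℝ := fun s => D s * (s - c) ^ (-β) with hg
  have hgd : ∀ s, c < s → HasDerivAt g
      ((3 / 2 * A s + 4 - 4 / (1 - β)) * (s - c) ^ (-β) + D s * (1 * (-β) * (s - c) ^ (-β - 1))) s := by
    intro s hs
    have hsc : s - c ≠ 0 := (sub_pos.2 hs).ne'
    have hp : HasDerivAt (fun x => (x - c) ^ (-β)) (1 * (-β) * (s - c) ^ (-β - 1)) s :=
      ((hasDerivAt_id s).sub_const c).rpow_const (Or.inl hsc)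
    exact (hDd s).mul hp
  have hgd_nonpos : ∀ s, c < s → s - c ≤ r →
      (3 / 2 * A s + 4 - 4 / (1 - β)) * (s - c) ^ (-β) + D s * (1 * (-β) * (s - c) ^ (-β - 1)) ≤ 0 := by
    intro s hs hsr
    have hsc : 0 < s - c := sub_pos.2 hs
    have hsplit : (s - c) ^ (-β) = (s - c) ^ (-β - 1) * (s - c) := by
      rw [← Real.rpow_add_one hsc.ne']; ring_nf
    have hP : 0 < (s - c) ^ (-β - 1) := Real.rpow_pos_of_pos hsc _
    rw [hsplit]
    have hk := hkey s hs hsr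
    nlinarith [hk, hP]
  -- `g` is antitone on `(c, c + r]`
  have hanti : AntitoneOn g (Ioc c (c + r)) := by
    apply antitoneOn_of_deriv_nonpos (convex_Ioc c (c + r))
    · exact fun s hs => (hgd s hs.1).continuousAt.continuousWithinAt
    · rw [interior_Ioc]
      exact fun s hs => (hgd s hs.1).differentiableAt.differentiableWithinAt
    · rw [interior_Ioc]
      intro s hs
      rw [(hgd s hs.1).deriv]
      exact hgd_nonpos s hs.1 (by linarith [hs.2])
  -- `g → 0` at `c⁺`
  have hlim : Tendsto g (𝓝[>] c) (𝓝 0) := by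
    have hslope : Tendsto (slope D c) (𝓝[>] c) (𝓝 (3 / 2 * A c + 4 - 4 / (1 - β))) :=
      ((hDd c).tendsto_slope).mono_left (nhdsWithin_mono c fun s hs => (ne_of_gt hs : s ≠ c))
    have hpow : Tendsto (fun s : ℝ => (s - c) ^ (1 - β)) (𝓝[>] c) (𝓝 0) := by
      have hcont : Continuous fun s : ℝ => (s - c) ^ (1 - β) :=
        (continuous_id.sub continuous_const).rpow_const fun x => Or.inr h1β.le
      have h0 : (c - c) ^ (1 - β) = 0 := by rw [sub_self, Real.zero_rpow h1β.ne']
      have := (hcont.tendsto c).mono_left (nhdsWithin_le_nhds (s := Ioi c))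
      rwa [h0] at this
    have hprod := hslope.mul hpow
    rw [mul_zero] at hprod
    refine hprod.congr' ?_
    filter_upwards [self_mem_nhdsWithin] with s hs
    have hsc : 0 < s - c := sub_pos.2 hs
    rw [slope_def_field, hDc, sub_zero, hg]
    have hsplit : (s - c) ^ (1 - β) = (s - c) ^ (-β) * (s - c) := by
      rw [← Real.rpow_add_one hsc.ne']; ring_nf
    rw [hsplit]
    field_simp
  -- hence `g τ ≤ 0`
  have hgτ : g τ ≤ 0 := by
    refine ge_of_tendsto hlim ?_
    filter_upwards [Ioo_mem_nhdsGT hτ] with s hs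
    exact hanti ⟨hs.1, by linarith [hs.2]⟩ ⟨hτ, by linarith⟩ hs.2.le
  -- unwind: `D τ ≤ 0`, `Q τ ≤ 4(τ − c)/(1 − β)`, `A τ ≤ 4/δ'`
  have hτc : 0 < τ - c := sub_pos.2 hτ
  have hDτ : D τ ≤ 0 := by
    have hP : 0 < (τ - c) ^ (-β) := Real.rpow_pos_of_pos hτc _
    have : D τ * (τ - c) ^ (-β) ≤ 0 := hgτ
    nlinarith
  have hQτ : w τ * A τ ≤ (4 / (1 - β)) * (τ - c) := by
    have : Q τ - (4 / (1 - β)) * (τ - c) ≤ 0 := hDτ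
    simp only [hQ] at this; linarith
  have hwτ : lam * (τ - c) ≤ w τ := hwlow τ hτ.le hτr
  have h3 : A τ * (lam * (τ - c)) ≤ (4 / (1 - β)) * (τ - c) :=
    (mul_le_mul_of_nonneg_left hwτ (hpos τ).le).trans (by linarith [mul_comm (A τ) (w τ)])
  have h4 : A τ * lam ≤ 4 / (1 - β) := by
    have : A τ * lam * (τ - c) ≤ (4 / (1 - β)) * (τ - c) := by linarith [mul_assoc (A τ) lam (τ - c)]
    exact le_of_mul_le_mul_right this hτc
  calc A τ = A τ * lam / lam := by field_simp
    _ ≤ (4 / (1 - β)) / lam := div_le_div_of_nonneg_right h4 hlam0.le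
    _ = 4 / δ' := by rw [← hβlam]; field_simp

/-- **CORE CEILING on a window around a uniformly supercritical zero** (both sides, by the reflection `s ↦ 2c − s`, `w ↦ −w`, which
preserves the area law): `3/2 + δ' ≤ w′` on `|s − c| ≤ r` gives `A(τ) ≤ 4/δ'` on `|τ − c| ≤ r`. [folklore] -/
theorem areaLaw_ceiling_window {w A : ℝ → ℝ} {c δ' r : ℝ} (hw : Differentiable ℝ w) (hA : Differentiable ℝ A)
    (hlaw : ∀ τ, w τ * deriv A τ = (3 / 2 - deriv w τ) * A τ + 4) (hpos : ∀ τ, 0 < A τ) (hc : w c = 0)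
    (hδ : 0 < δ') (hsup : ∀ s, |s - c| ≤ r → 3 / 2 + δ' ≤ deriv w s) {τ : ℝ} (hτr : |τ - c| ≤ r) :
    A τ ≤ 4 / δ' := by
  rcases lt_trichotomy c τ with hτ | rfl | hτ
  · exact areaLaw_ceiling_right hw hA hlaw hpos hc hδ hsup hτ (by rw [abs_of_pos (sub_pos.2 hτ)] at hτr; exact hτr)
  · obtain ⟨-, hAc⟩ :=
      Summit.NavierStokesRegularity.NavierStokesRegularity.Theorems.SkeletonJ1NormalBlockWindow.areaLaw_core_at_zero hlaw hpos hc
    have h := hsup c hτr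
    rw [hAc]
    exact div_le_div_of_nonneg_left (by norm_num) hδ (by linarith)
  · -- reflect: `w̃ s = −w(2c − s)`, `Ã s = A(2c − s)`
    set wr : ℝ → ℝ := fun s => -w (2 * c - s) with hwr
    set Ar : ℝ → ℝ := fun s => A (2 * c - s) with hAr
    have hrefl : ∀ s, HasDerivAt (fun x : ℝ => 2 * c - x) (-1) s := fun s => (hasDerivAt_id s).const_sub (2 * c)
    have hwrd : ∀ s, HasDerivAt wr (deriv w (2 * c - s)) s := fun s => by
      have h1 : HasDerivAt (fun x => w (2 * c - x)) (deriv w (2 * c - s) * (-1)) s :=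
        (hw (2 * c - s)).hasDerivAt.comp s (hrefl s)
      exact h1.neg.congr_deriv (by ring)
    have hArd : ∀ s, HasDerivAt Ar (-deriv A (2 * c - s)) s := fun s => by
      have h1 : HasDerivAt (fun x => A (2 * c - x)) (deriv A (2 * c - s) * (-1)) s :=
        (hA (2 * c - s)).hasDerivAt.comp s (hrefl s)
      exact h1.congr_deriv (by ring)
    have hwr_diff : Differentiable ℝ wr := fun s => (hwrd s).differentiableAt
    have hAr_diff : Differentiable ℝ Ar := fun s => (hArd s).differentiableAt
    have hlawr : ∀ s, wr s * deriv Ar s = (3 / 2 - deriv wr s) * Ar s + 4 := fun s => by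
      rw [(hArd s).deriv, (hwrd s).deriv]
      have := hlaw (2 * c - s)
      simp only [hwr, hAr]
      linarith
    have hposr : ∀ s, 0 < Ar s := fun s => hpos _
    have hcr : wr c = 0 := by simp [hwr, show 2 * c - c = c by ring, hc]
    have hsupr : ∀ s, |s - c| ≤ r → 3 / 2 + δ' ≤ deriv wr s := fun s hs => by
      rw [(hwrd s).deriv]
      exact hsup _ (by rw [show 2 * c - s - c = -(s - c) by ring, abs_neg]; exact hs)
    have hτ' : c < 2 * c - τ := by linarith
    have hτr' : 2 * c - τ - c ≤ r := by
      rw [abs_of_neg (sub_neg.2 hτ)] at hτr; linarith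
    have h := areaLaw_ceiling_right hwr_diff hAr_diff hlawr hposr hcr hδ hsupr hτ' hτr'
    simpa [hAr, show 2 * c - (2 * c - τ) = τ by ring] using h

end Summit.NavierStokesRegularity.NavierStokesRegularity.Theorems.SkeletonJ1NormalBlockCeiling

end
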